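import Mathlib.Analysis.InnerProductSpace.JointEigenspace
import Mathlib.Analysis.Matrix.Spectrum

/-!
# A joint orthonormal eigenbasis for a real symmetric matrix commuting with a real orthogonal
# matrix (DKLM 2026, Lemma 60: "`T(0)` and `T(π/2)` commute […] therefore co-diagonalisable")

Topic `LinearAlgebra/Matrix`, namespace `Literature.LinearAlgebra.Matrix`. For a real symmetric
matrix `A` and a real orthogonal matrix `P` (`P Pᵀ = 1`) with `A P = P A`, the complexified
matrices `A_ℂ` and `P_ℂ` have a common orthonormal basis of eigenvectors of `ℂⁿ`
(`jointEigenvectorBasis`), with real eigenvalues `jointEigenvalue` for `A_ℂ` and unimodular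
eigenvalues `jointPhase` for `P_ℂ`; if `P^m = 1` the phases are `m`-th roots of unity. The proof
runs Mathlib's joint-eigenspace decomposition for the commuting family of Hermitian operators
`A_ℂ`, `(P_ℂ + P_ℂᵀ)/2`, `(i/2)(P_ℂᵀ - P_ℂ)` (`P` is normal), collects orthonormal bases of the
joint eigenspaces and reindexes by `n`.

This is Lemma 60 of Duminil-Copin–Kozlowski–Lammers–Manolescu (arXiv:2603.06268) at the level of
matrices ("The basis `(v_k)_k` […] may be chosen such that it diagonalises `T(0)` as well. […]
the `Λ_k(0)` are `L`-th roots of unity"), the input of the spectral representation of the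
two-point function (their Theorem 23).

## References

* H. Duminil-Copin, K. K. Kozlowski, P. Lammers, I. Manolescu, arXiv:2603.06268 (2026), Part III
  §3, Lemma 60. [DKLM2026SixVertexGFF]
-/

noncomputable section

open Matrix Module.End

namespace Literature.LinearAlgebra.Matrix

variable {n : Type*} [Fintype n] [DecidableEq n]

/-! ### Complexification of real matrices -/

/-- The complexification `M_ℂ` of a real matrix. [folklore] -/
def cpx (M : Matrix n n ℝ) : Matrix n n ℂ :=
  M.map (algebraMap ℝ ℂ)

omit [Fintype n] [DecidableEq n] in
/-- Entries of the complexification. [folklore] -/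
@[simp] theorem cpx_apply (M : Matrix n n ℝ) (i j : n) : cpx M i j = (M i j : ℂ) := rfl

omit [DecidableEq n] in
/-- `(M N)_ℂ = M_ℂ N_ℂ`. [folklore] -/
theorem cpx_mul (M N : Matrix n n ℝ) : cpx (M * N) = cpx M * cpx N := by
  unfold cpx
  exact Matrix.map_mul

omit [Fintype n] in
/-- `1_ℂ = 1`. [folklore] -/
theorem cpx_one : cpx (1 : Matrix n n ℝ) = 1 := by
  unfold cpx
  exact Matrix.map_one _ (map_zero _) (map_one _)

omit [Fintype n] [DecidableEq n] in
/-- `(Mᵀ)_ℂ = (M_ℂ)ᵀ`. [folklore] -/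
theorem cpx_transpose (M : Matrix n n ℝ) : cpx Mᵀ = (cpx M)ᵀ := rfl

omit [Fintype n] [DecidableEq n] in
/-- Real matrices have `M_ℂᴴ = (Mᵀ)_ℂ`. [folklore] -/
theorem cpx_conjTranspose (M : Matrix n n ℝ) : (cpx M)ᴴ = cpx Mᵀ := by
  ext i j
  simp [cpx, Matrix.conjTranspose_apply]

omit [Fintype n] [DecidableEq n] in
/-- `(M + N)_ℂ = M_ℂ + N_ℂ`. [folklore] -/
theorem cpx_add (M N : Matrix n n ℝ) : cpx (M + N) = cpx M + cpx N := by
  ext i j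
  simp

omit [Fintype n] [DecidableEq n] in
/-- `(M - N)_ℂ = M_ℂ - N_ℂ`. [folklore] -/
theorem cpx_sub (M N : Matrix n n ℝ) : cpx (M - N) = cpx M - cpx N := by
  ext i j
  simp

omit [Fintype n] [DecidableEq n] in
/-- `(M_ℂ) *ᵥ (v ↦ (x v : ℂ)) = ((M *ᵥ x) : ℂ)` — complexification commutes with `mulVec` on real
vectors. [folklore] -/
theorem cpx_mulVec_ofReal [Fintype n] (M : Matrix n n ℝ) (x : n → ℝ) :
    cpx M *ᵥ (fun j => (x j : ℂ)) = fun i => ((M *ᵥ x) i : ℂ) := by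
  funext i
  simp [Matrix.mulVec, dotProduct]

omit [Fintype n] [DecidableEq n] in
/-- A real symmetric matrix complexifies to a Hermitian matrix. [folklore] -/
theorem isHermitian_cpx {A : Matrix n n ℝ} (hA : A.IsSymm) : (cpx A).IsHermitian := by
  rw [Matrix.IsHermitian, cpx_conjTranspose, hA.eq]

/-! ### The Hermitian and anti-Hermitian parts of an orthogonal matrix -/

/-- The symmetric part `(P_ℂ + P_ℂᵀ)/2`. [folklore] -/
def symPart (P : Matrix n n ℝ) : Matrix n n ℂ :=
  (1 / 2 : ℂ) • (cpx P + cpx Pᵀ)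

/-- The Hermitian matrix `(i/2)(P_ℂᵀ - P_ℂ)`. [folklore] -/
def skewPart (P : Matrix n n ℝ) : Matrix n n ℂ :=
  (Complex.I / 2) • (cpx Pᵀ - cpx P)

omit [Fintype n] [DecidableEq n] in
/-- `P_ℂ = symPart P + i · skewPart P`. [folklore] -/
theorem cpx_eq_symPart_add_I_smul_skewPart (P : Matrix n n ℝ) :
    cpx P = symPart P + Complex.I • skewPart P := by
  unfold symPart skewPart
  rw [smul_smul, show Complex.I * (Complex.I / 2) = -(1 / 2 : ℂ) by
    rw [mul_div_assoc', Complex.I_mul_I]; ring]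
  ext i j
  simp only [Matrix.add_apply, Matrix.smul_apply, Matrix.sub_apply, smul_eq_mul]
  ring

omit [Fintype n] [DecidableEq n] in
/-- `P_ℂᵀ = symPart P - i · skewPart P`. [folklore] -/
theorem cpx_transpose_eq_symPart_sub_I_smul_skewPart (P : Matrix n n ℝ) :
    cpx Pᵀ = symPart P - Complex.I • skewPart P := by
  unfold symPart skewPart
  rw [smul_smul, show Complex.I * (Complex.I / 2) = -(1 / 2 : ℂ) by
    rw [mul_div_assoc', Complex.I_mul_I]; ring]
  ext i j
  simp only [Matrix.add_apply, Matrix.smul_apply, Matrix.sub_apply, smul_eq_mul]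
  ring

omit [Fintype n] [DecidableEq n] in
/-- The symmetric part is Hermitian. [folklore] -/
theorem isHermitian_symPart (P : Matrix n n ℝ) : (symPart P).IsHermitian := by
  unfold symPart
  rw [Matrix.IsHermitian, Matrix.conjTranspose_smul, Matrix.conjTranspose_add, cpx_conjTranspose,
    cpx_conjTranspose, Matrix.transpose_transpose, add_comm]
  congr 1
  simp

omit [Fintype n] [DecidableEq n] in
/-- `(i/2)(Pᵀ - P)` is Hermitian. [folklore] -/
theorem isHermitian_skewPart (P : Matrix n n ℝ) : (skewPart P).IsHermitian := by
  unfold skewPart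
  rw [Matrix.IsHermitian, Matrix.conjTranspose_smul, Matrix.conjTranspose_sub, cpx_conjTranspose,
    cpx_conjTranspose, Matrix.transpose_transpose]
  rw [show star (Complex.I / 2) = -(Complex.I / 2) by simp [star_div₀, neg_div], neg_smul, ← smul_neg,
    neg_sub]

/-! ### Commutation relations -/

/-- `P Pᵀ = 1` implies `Pᵀ P = 1`. [folklore] -/
theorem transpose_mul_self_of_mul_transpose {P : Matrix n n ℝ} (hP : P * Pᵀ = 1) : Pᵀ * P = 1 :=
  mul_eq_one_comm.mp hP

omit [DecidableEq n] in
/-- A symmetric matrix commuting with `P` commutes with `Pᵀ`. [folklore] -/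
theorem mul_transpose_comm_of_comm {A P : Matrix n n ℝ} (hA : A.IsSymm) (hAP : A * P = P * A) :
    A * Pᵀ = Pᵀ * A := by
  have h := congrArg Matrix.transpose hAP
  rw [Matrix.transpose_mul, Matrix.transpose_mul, hA.eq] at h
  exact h.symm

omit [DecidableEq n] in
/-- `A_ℂ` commutes with the symmetric part. [folklore] -/
theorem cpx_mul_symPart_comm {A P : Matrix n n ℝ} (hA : A.IsSymm) (hAP : A * P = P * A) :
    cpx A * symPart P = symPart P * cpx A := by
  unfold symPart
  rw [Matrix.mul_smul, Matrix.smul_mul, Matrix.mul_add, Matrix.add_mul, ← cpx_mul, ← cpx_mul,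
    ← cpx_mul, ← cpx_mul, hAP, mul_transpose_comm_of_comm hA hAP]

omit [DecidableEq n] in
/-- `A_ℂ` commutes with the skew part. [folklore] -/
theorem cpx_mul_skewPart_comm {A P : Matrix n n ℝ} (hA : A.IsSymm) (hAP : A * P = P * A) :
    cpx A * skewPart P = skewPart P * cpx A := by
  unfold skewPart
  rw [Matrix.mul_smul, Matrix.smul_mul, Matrix.mul_sub, Matrix.sub_mul, ← cpx_mul, ← cpx_mul,
    ← cpx_mul, ← cpx_mul, hAP, mul_transpose_comm_of_comm hA hAP]

/-- The symmetric and skew parts of an orthogonal matrix commute (`P` is normal). [folklore] -/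
theorem symPart_mul_skewPart_comm {P : Matrix n n ℝ} (hP : P * Pᵀ = 1) :
    symPart P * skewPart P = skewPart P * symPart P := by
  have hP' := transpose_mul_self_of_mul_transpose hP
  unfold symPart skewPart
  rw [Matrix.mul_smul, Matrix.smul_mul, Matrix.mul_smul, Matrix.smul_mul, smul_smul, smul_smul,
    mul_comm (Complex.I / 2)]
  congr 1
  rw [Matrix.mul_sub, Matrix.sub_mul, Matrix.add_mul, Matrix.add_mul, Matrix.mul_add, Matrix.mul_add,
    ← cpx_mul, ← cpx_mul, ← cpx_mul, ← cpx_mul, hP, hP']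


/-! ### Powers and eigenvectors -/

/-- Powers act on eigenvectors by powers of the eigenvalue (any commutative ring). [folklore] -/
theorem pow_mulVec_eq_pow_smul {R : Type*} [CommRing R] {M : Matrix n n R}
    {v : n → R} {μ : R} (h : M *ᵥ v = μ • v) (m : ℕ) : M ^ m *ᵥ v = μ ^ m • v := by
  induction m with
  | zero => rw [pow_zero, pow_zero, one_mulVec, one_smul]
  | succ m ih => rw [pow_succ, ← mulVec_mulVec, h, mulVec_smul, ih, smul_smul, pow_succ']

/-! ### The commuting family of Hermitian operators on `ℂⁿ` -/

section Joint

variable (A P : Matrix n n ℝ)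

/-- The commuting family `(A_ℂ, (P_ℂ + P_ℂᵀ)/2, (i/2)(P_ℂᵀ - P_ℂ))` as operators on `ℂⁿ`.
[cite: DKLM2026SixVertexGFF, Lemma 60 (proof)] -/
def jointFamily : Fin 3 → (EuclideanSpace ℂ n →ₗ[ℂ] EuclideanSpace ℂ n) :=
  ![Matrix.toEuclideanLin (cpx A), Matrix.toEuclideanLin (symPart P),
    Matrix.toEuclideanLin (skewPart P)]

variable {A P}

/-- `(toEuclideanLin M v).ofLp = M *ᵥ v.ofLp`. [folklore] -/
theorem ofLp_toEuclideanLin (M : Matrix n n ℂ) (v : EuclideanSpace ℂ n) :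
    (Matrix.toEuclideanLin M v).ofLp = M *ᵥ v.ofLp := by
  rw [show Matrix.toEuclideanLin M = Matrix.toLpLin 2 2 M from rfl, Matrix.ofLp_toLpLin,
    Matrix.toLin'_apply]

/-- Commuting matrices give commuting operators. [folklore] -/
theorem commute_toEuclideanLin {M N : Matrix n n ℂ} (h : M * N = N * M) :
    Commute (Matrix.toEuclideanLin M) (Matrix.toEuclideanLin N) := by
  change Matrix.toEuclideanLin M * Matrix.toEuclideanLin N =
    Matrix.toEuclideanLin N * Matrix.toEuclideanLin M
  refine LinearMap.ext fun v => WithLp.ofLp_injective 2 ?_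
  simp only [Module.End.mul_apply, ofLp_toEuclideanLin, Matrix.mulVec_mulVec, h]

/-- The three operators are symmetric. [cite: DKLM2026SixVertexGFF, Lemma 60 (proof)] -/
theorem jointFamily_isSymmetric (hA : A.IsSymm) (i : Fin 3) : (jointFamily A P i).IsSymmetric := by
  fin_cases i
  · exact Matrix.isSymmetric_toEuclideanLin_iff.mpr (isHermitian_cpx hA)
  · exact Matrix.isSymmetric_toEuclideanLin_iff.mpr (isHermitian_symPart P)
  · exact Matrix.isSymmetric_toEuclideanLin_iff.mpr (isHermitian_skewPart P)

open scoped Function in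
/-- The three operators pairwise commute (`A P = P A`, `P Pᵀ = 1`, `A` symmetric).
[cite: DKLM2026SixVertexGFF, Lemma 60 (proof)] -/
theorem jointFamily_pairwise_commute (hA : A.IsSymm) (hP : P * Pᵀ = 1) (hAP : A * P = P * A) :
    Pairwise (Commute on jointFamily A P) := by
  intro i j hij
  fin_cases i <;> fin_cases j
  · exact absurd rfl hij
  · exact commute_toEuclideanLin (cpx_mul_symPart_comm hA hAP)
  · exact commute_toEuclideanLin (cpx_mul_skewPart_comm hA hAP)
  · exact (commute_toEuclideanLin (cpx_mul_symPart_comm hA hAP)).symm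
  · exact absurd rfl hij
  · exact commute_toEuclideanLin (symPart_mul_skewPart_comm hP)
  · exact (commute_toEuclideanLin (cpx_mul_skewPart_comm hA hAP)).symm
  · exact (commute_toEuclideanLin (symPart_mul_skewPart_comm hP)).symm
  · exact absurd rfl hij

variable (A P) in
/-- The finite index set of candidate joint eigenvalue triples. [folklore] -/
abbrev JointIdx : Type _ :=
  (j : Fin 3) → Module.End.Eigenvalues (jointFamily A P j)

variable (A P) in
/-- The joint eigenspace of a triple of eigenvalues. [cite: DKLM2026SixVertexGFF, Lemma 60] -/
def jointSpace (β : JointIdx A P) : Submodule ℂ (EuclideanSpace ℂ n) :=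
  ⨅ j, Module.End.eigenspace (jointFamily A P j) ((β j : ℂ))

/-- The joint eigenspaces indexed by eigenvalue triples exhaust `ℂⁿ`.
[cite: DKLM2026SixVertexGFF, Lemma 60] -/
theorem iSup_jointSpace_eq_top (hA : A.IsSymm) (hP : P * Pᵀ = 1) (hAP : A * P = P * A) :
    ⨆ β, jointSpace A P β = ⊤ := by
  have h := LinearMap.IsSymmetric.iSup_iInf_eq_top_of_commute (jointFamily_isSymmetric (P := P) hA)
    (jointFamily_pairwise_commute hA hP hAP)
  refine le_antisymm le_top ?_
  rw [← h]
  refine iSup_le fun χ => ?_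
  by_cases hχ : ∀ j, Module.End.HasEigenvalue (jointFamily A P j) (χ j)
  · exact le_iSup_of_le (fun j => ⟨χ j, hχ j⟩) le_rfl
  · push Not at hχ
    obtain ⟨j₀, hj₀⟩ := hχ
    rw [Module.End.hasEigenvalue_iff, not_not] at hj₀
    have : (⨅ j, Module.End.eigenspace (jointFamily A P j) (χ j)) = ⊥ :=
      le_bot_iff.mp ((iInf_le _ j₀).trans hj₀.le)
    rw [this]
    exact bot_le

/-- The joint eigenspaces are mutually orthogonal. [cite: DKLM2026SixVertexGFF, Lemma 60] -/
theorem orthogonalFamily_jointSpace (hA : A.IsSymm) :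
    OrthogonalFamily ℂ (fun β => ↥(jointSpace A P β)) fun β => (jointSpace A P β).subtypeₗᵢ :=
  (LinearMap.IsSymmetric.orthogonalFamily_iInf_eigenspaces
    (jointFamily_isSymmetric (P := P) hA)).comp
    (f := fun (β : JointIdx A P) (j : Fin 3) => ((β j : ℂ)))
    (fun _ _ h => funext fun j => Subtype.ext (congrFun h j))

open scoped Classical in
/-- `ℂⁿ` is the internal orthogonal direct sum of the joint eigenspaces.
[cite: DKLM2026SixVertexGFF, Lemma 60] -/
theorem isInternal_jointSpace (hA : A.IsSymm) (hP : P * Pᵀ = 1) (hAP : A * P = P * A) :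
    DirectSum.IsInternal (jointSpace A P) := by
  rw [(orthogonalFamily_jointSpace (P := P) hA).isInternal_iff, iSup_jointSpace_eq_top hA hP hAP,
    Submodule.top_orthogonal_eq_bot]

open scoped Classical in
/-- The collected orthonormal basis of joint eigenvectors (before reindexing by `n`).
[cite: DKLM2026SixVertexGFF, Lemma 60] -/
def rawJointBasis (hA : A.IsSymm) (hP : P * Pᵀ = 1) (hAP : A * P = P * A) :
    OrthonormalBasis ((β : JointIdx A P) × Fin (Module.finrank ℂ (jointSpace A P β))) ℂ
      (EuclideanSpace ℂ n) :=
  (isInternal_jointSpace hA hP hAP).collectedOrthonormalBasis (orthogonalFamily_jointSpace hA)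
    fun β => stdOrthonormalBasis ℂ (jointSpace A P β)

open scoped Classical in
/-- The raw basis vectors lie in their joint eigenspaces. [folklore] -/
theorem rawJointBasis_mem (hA : A.IsSymm) (hP : P * Pᵀ = 1) (hAP : A * P = P * A)
    (a : (β : JointIdx A P) × Fin (Module.finrank ℂ (jointSpace A P β))) :
    rawJointBasis hA hP hAP a ∈ jointSpace A P a.1 :=
  (isInternal_jointSpace hA hP hAP).collectedOrthonormalBasis_mem (orthogonalFamily_jointSpace hA) _ a

open scoped Classical in
/-- The raw index set has the cardinality of `n`. [folklore] -/
theorem card_rawIdx (hA : A.IsSymm) (hP : P * Pᵀ = 1) (hAP : A * P = P * A) :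
    Fintype.card ((β : JointIdx A P) × Fin (Module.finrank ℂ (jointSpace A P β))) = Fintype.card n := by
  rw [← Module.finrank_eq_card_basis (rawJointBasis hA hP hAP).toBasis, finrank_euclideanSpace]

open scoped Classical in
/-- **The joint orthonormal eigenbasis** of `A_ℂ` and `P_ℂ`, indexed by `n`
(Lemma 60: a basis diagonalising `T(π/2)` and `T(0)` simultaneously).
[cite: DKLM2026SixVertexGFF, Lemma 60] -/
def jointEigenvectorBasis (hA : A.IsSymm) (hP : P * Pᵀ = 1) (hAP : A * P = P * A) :
    OrthonormalBasis n ℂ (EuclideanSpace ℂ n) :=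
  (rawJointBasis hA hP hAP).reindex (Fintype.equivOfCardEq (card_rawIdx hA hP hAP))

open scoped Classical in
/-- The eigenvalue triple of the `i`-th joint eigenvector. [folklore] -/
def jointIndex (hA : A.IsSymm) (hP : P * Pᵀ = 1) (hAP : A * P = P * A) (i : n) : JointIdx A P :=
  ((Fintype.equivOfCardEq (card_rawIdx hA hP hAP)).symm i).1

open scoped Classical in
/-- The `i`-th joint eigenvector lies in the joint eigenspace of its triple. [folklore] -/
theorem jointEigenvectorBasis_mem (hA : A.IsSymm) (hP : P * Pᵀ = 1) (hAP : A * P = P * A) (i : n) :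
    jointEigenvectorBasis hA hP hAP i ∈ jointSpace A P (jointIndex hA hP hAP i) := by
  unfold jointEigenvectorBasis jointIndex
  rw [OrthonormalBasis.reindex_apply]
  exact rawJointBasis_mem hA hP hAP _

/-- Membership in a joint eigenspace, operator by operator. [folklore] -/
theorem apply_eq_smul_of_mem_jointSpace {β : JointIdx A P} {v : EuclideanSpace ℂ n}
    (hv : v ∈ jointSpace A P β) (j : Fin 3) : jointFamily A P j v = ((β j : ℂ)) • v := by
  unfold jointSpace at hv
  rw [Submodule.mem_iInf] at hv
  exact Module.End.mem_eigenspace_iff.mp (hv j)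

/-- **The eigenvalues of `A`** along the joint eigenbasis (real, `A` being symmetric).
[cite: DKLM2026SixVertexGFF, Lemma 60] -/
def jointEigenvalue (hA : A.IsSymm) (hP : P * Pᵀ = 1) (hAP : A * P = P * A) (i : n) : ℝ :=
  (((jointIndex hA hP hAP i) 0 : ℂ)).re

/-- **The eigenvalues `Λ_k(0)` of `P`** along the joint eigenbasis.
[cite: DKLM2026SixVertexGFF, Lemma 60] -/
def jointPhase (hA : A.IsSymm) (hP : P * Pᵀ = 1) (hAP : A * P = P * A) (i : n) : ℂ :=
  ((jointIndex hA hP hAP i) 1 : ℂ) + Complex.I * ((jointIndex hA hP hAP i) 2 : ℂ)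

/-- The eigenvalues of a symmetric operator in the index set are real. [folklore] -/
theorem jointIndex_conj (hA : A.IsSymm) (hP : P * Pᵀ = 1) (hAP : A * P = P * A) (i : n) (j : Fin 3) :
    (starRingEnd ℂ) ((jointIndex hA hP hAP i) j : ℂ) = ((jointIndex hA hP hAP i) j : ℂ) :=
  (jointFamily_isSymmetric (P := P) hA j).conj_eigenvalue_eq_self ((jointIndex hA hP hAP i) j).2

/-- **`A_ℂ vᵢ = λᵢ vᵢ`** along the joint eigenbasis. [cite: DKLM2026SixVertexGFF, Lemma 60] -/
theorem cpx_mulVec_jointEigenvectorBasis (hA : A.IsSymm) (hP : P * Pᵀ = 1) (hAP : A * P = P * A)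
    (i : n) :
    cpx A *ᵥ ⇑(jointEigenvectorBasis hA hP hAP i) =
      ((jointEigenvalue hA hP hAP i : ℝ) : ℂ) • ⇑(jointEigenvectorBasis hA hP hAP i) := by
  have h : Matrix.toEuclideanLin (cpx A) (jointEigenvectorBasis hA hP hAP i) =
      ((jointIndex hA hP hAP i 0 : ℂ)) • jointEigenvectorBasis hA hP hAP i :=
    apply_eq_smul_of_mem_jointSpace (jointEigenvectorBasis_mem hA hP hAP i) 0
  have h' := congrArg WithLp.ofLp h
  rw [ofLp_toEuclideanLin, WithLp.ofLp_smul] at h'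
  rw [h']
  congr 1
  unfold jointEigenvalue
  exact (Complex.conj_eq_iff_re.mp (jointIndex_conj hA hP hAP i 0)).symm

/-- **`P_ℂ vᵢ = ωᵢ vᵢ`** along the joint eigenbasis. [cite: DKLM2026SixVertexGFF, Lemma 60] -/
theorem cpxP_mulVec_jointEigenvectorBasis (hA : A.IsSymm) (hP : P * Pᵀ = 1) (hAP : A * P = P * A)
    (i : n) :
    cpx P *ᵥ ⇑(jointEigenvectorBasis hA hP hAP i) =
      jointPhase hA hP hAP i • ⇑(jointEigenvectorBasis hA hP hAP i) := by
  have h1 : Matrix.toEuclideanLin (symPart P) (jointEigenvectorBasis hA hP hAP i) =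
      ((jointIndex hA hP hAP i 1 : ℂ)) • jointEigenvectorBasis hA hP hAP i :=
    apply_eq_smul_of_mem_jointSpace (jointEigenvectorBasis_mem hA hP hAP i) 1
  have h2 : Matrix.toEuclideanLin (skewPart P) (jointEigenvectorBasis hA hP hAP i) =
      ((jointIndex hA hP hAP i 2 : ℂ)) • jointEigenvectorBasis hA hP hAP i :=
    apply_eq_smul_of_mem_jointSpace (jointEigenvectorBasis_mem hA hP hAP i) 2
  have h1' := congrArg WithLp.ofLp h1
  have h2' := congrArg WithLp.ofLp h2
  rw [ofLp_toEuclideanLin, WithLp.ofLp_smul] at h1' h2'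
  rw [cpx_eq_symPart_add_I_smul_skewPart, Matrix.add_mulVec, Matrix.smul_mulVec, h1', h2',
    smul_smul, ← add_smul]
  rfl

/-- **`Pᵀ_ℂ vᵢ = ω̄ᵢ vᵢ`** (the conjugate phase, as the symmetric/skew eigenvalues are real).
[cite: DKLM2026SixVertexGFF, Lemma 60] -/
theorem cpxPT_mulVec_jointEigenvectorBasis (hA : A.IsSymm) (hP : P * Pᵀ = 1) (hAP : A * P = P * A)
    (i : n) :
    cpx Pᵀ *ᵥ ⇑(jointEigenvectorBasis hA hP hAP i) =
      (starRingEnd ℂ) (jointPhase hA hP hAP i) • ⇑(jointEigenvectorBasis hA hP hAP i) := by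
  have h1 : Matrix.toEuclideanLin (symPart P) (jointEigenvectorBasis hA hP hAP i) =
      ((jointIndex hA hP hAP i 1 : ℂ)) • jointEigenvectorBasis hA hP hAP i :=
    apply_eq_smul_of_mem_jointSpace (jointEigenvectorBasis_mem hA hP hAP i) 1
  have h2 : Matrix.toEuclideanLin (skewPart P) (jointEigenvectorBasis hA hP hAP i) =
      ((jointIndex hA hP hAP i 2 : ℂ)) • jointEigenvectorBasis hA hP hAP i :=
    apply_eq_smul_of_mem_jointSpace (jointEigenvectorBasis_mem hA hP hAP i) 2
  have h1' := congrArg WithLp.ofLp h1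
  have h2' := congrArg WithLp.ofLp h2
  rw [ofLp_toEuclideanLin, WithLp.ofLp_smul] at h1' h2'
  rw [cpx_transpose_eq_symPart_sub_I_smul_skewPart, Matrix.sub_mulVec, Matrix.smul_mulVec, h1',
    h2', smul_smul, ← sub_smul]
  congr 1
  unfold jointPhase
  rw [map_add, map_mul, Complex.conj_I, jointIndex_conj, jointIndex_conj]
  ring

/-- The joint eigenvectors are nonzero. [folklore] -/
theorem jointEigenvectorBasis_ne_zero (hA : A.IsSymm) (hP : P * Pᵀ = 1) (hAP : A * P = P * A)
    (i : n) : (⇑(jointEigenvectorBasis hA hP hAP i) : n → ℂ) ≠ 0 := by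
  intro h
  have h1 := (jointEigenvectorBasis hA hP hAP).norm_eq_one i
  have h0 : jointEigenvectorBasis hA hP hAP i = 0 := by
    apply WithLp.ofLp_injective 2
    rw [h]
    rfl
  rw [h0, norm_zero] at h1
  exact zero_ne_one h1

/-- **The phases are unimodular**: `ω̄ᵢ ωᵢ = 1` (`P` is orthogonal).
[cite: DKLM2026SixVertexGFF, Lemma 60] -/
theorem conj_jointPhase_mul_self (hA : A.IsSymm) (hP : P * Pᵀ = 1) (hAP : A * P = P * A) (i : n) :
    (starRingEnd ℂ) (jointPhase hA hP hAP i) * jointPhase hA hP hAP i = 1 := by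
  set v : n → ℂ := ⇑(jointEigenvectorBasis hA hP hAP i) with hv
  have hPv := cpxP_mulVec_jointEigenvectorBasis hA hP hAP i
  have hPTv := cpxPT_mulVec_jointEigenvectorBasis hA hP hAP i
  have hone : cpx Pᵀ *ᵥ (cpx P *ᵥ v) = v := by
    rw [Matrix.mulVec_mulVec, ← cpx_mul, transpose_mul_self_of_mul_transpose hP, cpx_one, one_mulVec]
  rw [← hv] at hPv hPTv
  rw [hPv, mulVec_smul, hPTv, smul_smul, mul_comm] at hone
  have h2 : ((starRingEnd ℂ) (jointPhase hA hP hAP i) * jointPhase hA hP hAP i - 1) • v = 0 := by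
    rw [sub_smul, one_smul, hone, sub_self]
  rcases smul_eq_zero.mp h2 with h3 | h3
  · exact sub_eq_zero.mp h3
  · exact absurd h3 (jointEigenvectorBasis_ne_zero hA hP hAP i)

/-- **`|ωᵢ| = 1`.** [cite: DKLM2026SixVertexGFF, Lemma 60] -/
theorem norm_jointPhase (hA : A.IsSymm) (hP : P * Pᵀ = 1) (hAP : A * P = P * A) (i : n) :
    ‖jointPhase hA hP hAP i‖ = 1 := by
  have h := conj_jointPhase_mul_self hA hP hAP i
  rw [Complex.conj_mul'] at h
  have h2 : (‖jointPhase hA hP hAP i‖ : ℝ) ^ 2 = 1 := by exact_mod_cast h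
  nlinarith [norm_nonneg (jointPhase hA hP hAP i)]

/-- **If `P^m = 1` the phases are `m`-th roots of unity** (Lemma 60: "Since `T(0)^L = Identity`,
its eigenvalues are `L`-th roots of unity"). [cite: DKLM2026SixVertexGFF, Lemma 60] -/
theorem jointPhase_pow_eq_one (hA : A.IsSymm) (hP : P * Pᵀ = 1) (hAP : A * P = P * A) {m : ℕ}
    (hm : P ^ m = 1) (i : n) : jointPhase hA hP hAP i ^ m = 1 := by
  set v : n → ℂ := ⇑(jointEigenvectorBasis hA hP hAP i) with hv
  have hPv := cpxP_mulVec_jointEigenvectorBasis hA hP hAP i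
  rw [← hv] at hPv
  have h1 : cpx P ^ m *ᵥ v = v := by
    rw [show cpx P ^ m = cpx (P ^ m) by unfold cpx; exact (Matrix.map_pow P (algebraMap ℝ ℂ) m).symm,
      hm, cpx_one, one_mulVec]
  rw [pow_mulVec_eq_pow_smul hPv m] at h1
  have h2 : (jointPhase hA hP hAP i ^ m - 1) • v = 0 := by rw [sub_smul, one_smul, h1, sub_self]
  rcases smul_eq_zero.mp h2 with h3 | h3
  · exact sub_eq_zero.mp h3
  · exact absurd h3 (jointEigenvectorBasis_ne_zero hA hP hAP i)

/-! ### Matrix form: a unitary matrix of joint eigenvectors -/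

/-- **The unitary matrix `U` whose columns are the joint eigenvectors.**
[cite: DKLM2026SixVertexGFF, Lemma 60] -/
def jointUnitary (hA : A.IsSymm) (hP : P * Pᵀ = 1) (hAP : A * P = P * A) : Matrix n n ℂ :=
  (EuclideanSpace.basisFun n ℂ).toBasis.toMatrix ⇑(jointEigenvectorBasis hA hP hAP)

/-- `U` is unitary. [cite: DKLM2026SixVertexGFF, Lemma 60] -/
theorem jointUnitary_mem_unitaryGroup (hA : A.IsSymm) (hP : P * Pᵀ = 1) (hAP : A * P = P * A) :
    jointUnitary hA hP hAP ∈ Matrix.unitaryGroup n ℂ :=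
  (EuclideanSpace.basisFun n ℂ).toMatrix_orthonormalBasis_mem_unitary (jointEigenvectorBasis hA hP hAP)

/-- The entries of `U`: `U i j = (v_j)_i`. [folklore] -/
theorem jointUnitary_apply (hA : A.IsSymm) (hP : P * Pᵀ = 1) (hAP : A * P = P * A) (i j : n) :
    jointUnitary hA hP hAP i j = (⇑(jointEigenvectorBasis hA hP hAP j) : n → ℂ) i :=
  rfl

/-- **`A_ℂ U = U diag(λ)`**: `U` diagonalises `A`. [cite: DKLM2026SixVertexGFF, Lemma 60] -/
theorem cpx_mul_jointUnitary (hA : A.IsSymm) (hP : P * Pᵀ = 1) (hAP : A * P = P * A) :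
    cpx A * jointUnitary hA hP hAP =
      jointUnitary hA hP hAP * Matrix.diagonal fun j => ((jointEigenvalue hA hP hAP j : ℝ) : ℂ) := by
  ext i j
  have h := congrFun (cpx_mulVec_jointEigenvectorBasis hA hP hAP j) i
  rw [Matrix.mul_diagonal, Matrix.mul_apply]
  simp only [jointUnitary_apply]
  rw [Matrix.mulVec, dotProduct] at h
  rw [h, Pi.smul_apply, smul_eq_mul, mul_comm]

/-- **`P_ℂ U = U diag(ω)`**: `U` diagonalises `P`. [cite: DKLM2026SixVertexGFF, Lemma 60] -/
theorem cpxP_mul_jointUnitary (hA : A.IsSymm) (hP : P * Pᵀ = 1) (hAP : A * P = P * A) :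
    cpx P * jointUnitary hA hP hAP =
      jointUnitary hA hP hAP * Matrix.diagonal (jointPhase hA hP hAP) := by
  ext i j
  have h := congrFun (cpxP_mulVec_jointEigenvectorBasis hA hP hAP j) i
  rw [Matrix.mul_diagonal, Matrix.mul_apply]
  simp only [jointUnitary_apply]
  rw [Matrix.mulVec, dotProduct] at h
  rw [h, Pi.smul_apply, smul_eq_mul, mul_comm]

end Joint

end Literature.LinearAlgebra.Matrix

end
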